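import Summits.Ventures.PercRepro.RankLevelSetRuleQSliceTailThree
import Summits.Ventures.PercRepro.RankLevelSetRuleQSliceTailDecay
import Summits.Ventures.PercRepro.RankLevelSetRuleQSliceRhoPath
import Summits.Ventures.PercRepro.RankLevelSetRuleQSliceBorderStatus
import Summits.Ventures.PercRepro.RankLevelSetRuleQBorderline

/-!
# PercRepro — THE BORDERLINE SLICE `u = k − 2` IS PAID IN EVERY CELL `(q+k, q)`, `k ≥ 5`, `q ≥ k − 2`
(night-1, gen 21; dossier §32 — the conjecture of record §28.7, complete)

* **`phiK_le_rhat_gap_of_Z`** — a cell beyond the density range (`K(K+1) < 2m`, so `(K+1)(K−2) ≤ 2m` and `K(K+3) ≤ 2M`) with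
  `m + K + 1 ≤ M_b` is paid as soon as `(18/5)·M_b·decayProd (K+2) (K+4) M_b ≤ (K+1)(K−1)`: the path bound
  `T ≤ (K+1)(K−1)/(4(m+K+1))` of `phiK_le_rhat_border_of_tail` follows from `T(m) ≤ T(3)·decayProd ≤ (9/10)·decayProd`
  (`borderTail_le_three_mul_decay`, `borderTail_three_le`) and the monotonicity of `Z = M·decayProd` (`decay_Z_mono`);
* **`gap_k11` … `gap_k19`** — the gap cells beyond the density range, `K(K+1) < 2m`, `q < q₁(k)`, by `phiK_le_rhat_gap_of_Z`
  from ONE rational inequality per family (`(18/5)·q₁·decayProd (K+2) (K+4) q₁ ≤ (K+1)(K−1)`; the left sides are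
  `20.25, 11.22, 8.19, 5.00, 3.62, 2.36, 1.67, 1.13, 0.79` against `80, 99, 120, 143, 168, 195, 224, 255, 288`);
* **`border_k11_all` … `border_k19_all`** — every `q ≥ k − 2` for `11 ≤ k ≤ 19`: the bottom regime
  (`phiK_le_rhat_bottom_regime`), the gap cells, and the landed thresholds (`border_k11`, `border_even_k12`, …);
* **`rhat_borderline_all (k q) (5 ≤ k) (k − 2 ≤ q) : Φ(q+k, q) ≤ R̂(q, k, q − (k−2))`** — `k ≤ 10` by
  `rhat_borderline_of_le_ten`, `11 ≤ k ≤ 19` above, `k ≥ 20` by the bottom regime below `k(k−3)/2` and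
  `phiK_le_rhat_border_twenty` from there;
* **`ruleQRecv_ge_phiK_borderline_all`** — the matroid level: at the tight layer `#E = (q+k) + q` of every finite matroid, every
  member `Z` of the cell `(q+k, q)` with `#(flatPart M Z) = q − (k−2)` receives at least `Φ(q+k, q)` under Rule Q's equal split,
  for every `k ≥ 5` and every `q ≥ k − 2`.
Axioms: standard.
-/

namespace PercRepro

open Finset

/-- **A GAP CELL FROM ONE NUMBER**: `2 ≤ K`, `K(K+1) < 2m` (beyond the density range, hence on `q ≥ k(k−3)/2`),
`m + K + 1 ≤ M_b`, and `(18/5)·M_b·decayProd (K+2) (K+4) M_b ≤ (K+1)(K−1)` ⇒ `Φ(q+k, q) ≤ R̂(q, k, m)` (`k = K+2`, `q = m+K`):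
`T(m) ≤ (9/10)·decayProd(m+K+1) ≤ (9/10)·M_b·decayProd(M_b)/(m+K+1) ≤ (K+1)(K−1)/(4(m+K+1))`. -/
theorem phiK_le_rhat_gap_of_Z (K m Mb : ℕ) (hK : 2 ≤ K) (hm : K * (K + 1) < 2 * m) (hMb : m + K + 1 ≤ Mb)
    (hnum : (18 / 5 : ℚ) * ((Mb : ℚ) * decayProd (K + 2) (K + 4) Mb) ≤ ((K : ℚ) + 1) * ((K : ℚ) - 1)) :
    phiK (m + K + (K + 2)) (m + K) ≤ rhat (m + K) (K + 2) m := by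
  have hslope : (K + 1) * (K - 2) ≤ 2 * m :=
    calc (K + 1) * (K - 2) ≤ (K + 1) * K := Nat.mul_le_mul_left _ (Nat.sub_le K 2)
      _ = K * (K + 1) := Nat.mul_comm _ _
      _ ≤ 2 * m := hm.le
  apply phiK_le_rhat_border_of_tail m K hK hslope
  show borderTail m K ≤ _
  have h1 := borderTail_le_three_mul_decay K m (by nlinarith)
  have h2 := borderTail_three_le K
  have hP := decayProd_nonneg (K + 2) (K + 4) (m + K + 1)
  have hZ := decay_Z_mono (K + 2) (K + 4) (m + K + 1) Mb (by omega) (by omega) (by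
    rw [show K + 2 - 2 = K by omega]; nlinarith) hMb
  have hM : (0 : ℚ) < ((m + K + 1 : ℕ) : ℚ) := by positivity
  have hT : borderTail m K ≤ (9 / 10) * decayProd (K + 2) (K + 4) (m + K + 1) :=
    h1.trans (mul_le_mul_of_nonneg_right h2 hP)
  have hgoal : (9 / 10 : ℚ) * decayProd (K + 2) (K + 4) (m + K + 1)
      ≤ ((K : ℚ) + 1) * ((K : ℚ) - 1) / (4 * (((m + K + 1 : ℕ) : ℚ))) := by
    rw [le_div_iff₀ (by positivity)]
    nlinarith
  push_cast at hgoal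
  linarith

/-- The gap cells of `k = 11` (`K = 9`): `90 < 2m`, `q = m + 9 < 158`. -/
theorem gap_k11 (m : ℕ) (hm : 9 * 10 < 2 * m) (hq : m + 9 + 1 ≤ 158) :
    phiK (m + 9 + (9 + 2)) (m + 9) ≤ rhat (m + 9) (9 + 2) m :=
  phiK_le_rhat_gap_of_Z 9 m 158 (by norm_num) hm hq (by
    unfold decayProd
    simp only [Finset.prod_range_succ, Finset.prod_range_zero]
    norm_num)

/-- The gap cells of `k = 12` (`K = 10`): `110 < 2m`, `q = m + 10 < 137`. -/
theorem gap_k12 (m : ℕ) (hm : 10 * 11 < 2 * m) (hq : m + 10 + 1 ≤ 137) :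
    phiK (m + 10 + (10 + 2)) (m + 10) ≤ rhat (m + 10) (10 + 2) m :=
  phiK_le_rhat_gap_of_Z 10 m 137 (by norm_num) hm hq (by
    unfold decayProd
    simp only [Finset.prod_range_succ, Finset.prod_range_zero]
    norm_num)

/-- The gap cells of `k = 13` (`K = 11`): `132 < 2m`, `q = m + 11 < 156`. -/
theorem gap_k13 (m : ℕ) (hm : 11 * 12 < 2 * m) (hq : m + 11 + 1 ≤ 156) :
    phiK (m + 11 + (11 + 2)) (m + 11) ≤ rhat (m + 11) (11 + 2) m :=
  phiK_le_rhat_gap_of_Z 11 m 156 (by norm_num) hm hq (by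
    unfold decayProd
    simp only [Finset.prod_range_succ, Finset.prod_range_zero]
    norm_num)

/-- The gap cells of `k = 14` (`K = 12`): `156 < 2m`, `q = m + 12 < 140`. -/
theorem gap_k14 (m : ℕ) (hm : 12 * 13 < 2 * m) (hq : m + 12 + 1 ≤ 140) :
    phiK (m + 12 + (12 + 2)) (m + 12) ≤ rhat (m + 12) (12 + 2) m :=
  phiK_le_rhat_gap_of_Z 12 m 140 (by norm_num) hm hq (by
    unfold decayProd
    simp only [Finset.prod_range_succ, Finset.prod_range_zero]
    norm_num)

/-- The gap cells of `k = 15` (`K = 13`): `182 < 2m`, `q = m + 13 < 160`. -/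
theorem gap_k15 (m : ℕ) (hm : 13 * 14 < 2 * m) (hq : m + 13 + 1 ≤ 160) :
    phiK (m + 13 + (13 + 2)) (m + 13) ≤ rhat (m + 13) (13 + 2) m :=
  phiK_le_rhat_gap_of_Z 13 m 160 (by norm_num) hm hq (by
    unfold decayProd
    simp only [Finset.prod_range_succ, Finset.prod_range_zero]
    norm_num)

/-- The gap cells of `k = 16` (`K = 14`): `210 < 2m`, `q = m + 14 < 147`. -/
theorem gap_k16 (m : ℕ) (hm : 14 * 15 < 2 * m) (hq : m + 14 + 1 ≤ 147) :
    phiK (m + 14 + (14 + 2)) (m + 14) ≤ rhat (m + 14) (14 + 2) m :=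
  phiK_le_rhat_gap_of_Z 14 m 147 (by norm_num) hm hq (by
    unfold decayProd
    simp only [Finset.prod_range_succ, Finset.prod_range_zero]
    norm_num)

/-- The gap cells of `k = 17` (`K = 15`): `240 < 2m`, `q = m + 15 < 167`. -/
theorem gap_k17 (m : ℕ) (hm : 15 * 16 < 2 * m) (hq : m + 15 + 1 ≤ 167) :
    phiK (m + 15 + (15 + 2)) (m + 15) ≤ rhat (m + 15) (15 + 2) m :=
  phiK_le_rhat_gap_of_Z 15 m 167 (by norm_num) hm hq (by
    unfold decayProd
    simp only [Finset.prod_range_succ, Finset.prod_range_zero]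
    norm_num)

/-- The gap cells of `k = 18` (`K = 16`): `272 < 2m`, `q = m + 16 < 155`. -/
theorem gap_k18 (m : ℕ) (hm : 16 * 17 < 2 * m) (hq : m + 16 + 1 ≤ 155) :
    phiK (m + 16 + (16 + 2)) (m + 16) ≤ rhat (m + 16) (16 + 2) m :=
  phiK_le_rhat_gap_of_Z 16 m 155 (by norm_num) hm hq (by
    unfold decayProd
    simp only [Finset.prod_range_succ, Finset.prod_range_zero]
    norm_num)

/-- The gap cells of `k = 19` (`K = 17`): `306 < 2m`, `q = m + 17 < 176`. -/
theorem gap_k19 (m : ℕ) (hm : 17 * 18 < 2 * m) (hq : m + 17 + 1 ≤ 176) :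
    phiK (m + 17 + (17 + 2)) (m + 17) ≤ rhat (m + 17) (17 + 2) m :=
  phiK_le_rhat_gap_of_Z 17 m 176 (by norm_num) hm hq (by
    unfold decayProd
    simp only [Finset.prod_range_succ, Finset.prod_range_zero]
    norm_num)

/-- **The borderline of `k = 11` for every `q ≥ 9`.** -/
theorem border_k11_all (q : ℕ) (hq : 9 ≤ q) : phiK (q + 11) q ≤ rhat q 11 (q - 9) := by
  rcases Nat.lt_or_ge q 158 with h | h
  · rcases Nat.lt_or_ge (2 * (q - 9)) (9 * 10 + 1) with hd | hd
    · exact phiK_le_rhat_bottom_regime 11 q (by norm_num) (by omega) (by omega)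
    · obtain ⟨m, rfl⟩ : ∃ m, q = m + 9 := ⟨q - 9, by omega⟩
      rw [show m + 9 - 9 = m by omega]
      exact gap_k11 m (by omega) (by omega)
  · exact border_k11 q h

/-- **The borderline of `k = 12` for every `q ≥ 10`.** -/
theorem border_k12_all (q : ℕ) (hq : 10 ≤ q) : phiK (q + 12) q ≤ rhat q 12 (q - 10) := by
  rcases Nat.lt_or_ge q 137 with h | h
  · rcases Nat.lt_or_ge (2 * (q - 10)) (10 * 11 + 1) with hd | hd
    · exact phiK_le_rhat_bottom_regime 12 q (by norm_num) (by omega) (by omega)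
    · obtain ⟨m, rfl⟩ : ∃ m, q = m + 10 := ⟨q - 10, by omega⟩
      rw [show m + 10 - 10 = m by omega]
      exact gap_k12 m (by omega) (by omega)
  · exact border_even_k12 q h

/-- **The borderline of `k = 13` for every `q ≥ 11`.** -/
theorem border_k13_all (q : ℕ) (hq : 11 ≤ q) : phiK (q + 13) q ≤ rhat q 13 (q - 11) := by
  rcases Nat.lt_or_ge q 156 with h | h
  · rcases Nat.lt_or_ge (2 * (q - 11)) (11 * 12 + 1) with hd | hd
    · exact phiK_le_rhat_bottom_regime 13 q (by norm_num) (by omega) (by omega)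
    · obtain ⟨m, rfl⟩ : ∃ m, q = m + 11 := ⟨q - 11, by omega⟩
      rw [show m + 11 - 11 = m by omega]
      exact gap_k13 m (by omega) (by omega)
  · exact border_k13 q h

/-- **The borderline of `k = 14` for every `q ≥ 12`.** -/
theorem border_k14_all (q : ℕ) (hq : 12 ≤ q) : phiK (q + 14) q ≤ rhat q 14 (q - 12) := by
  rcases Nat.lt_or_ge q 140 with h | h
  · rcases Nat.lt_or_ge (2 * (q - 12)) (12 * 13 + 1) with hd | hd
    · exact phiK_le_rhat_bottom_regime 14 q (by norm_num) (by omega) (by omega)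
    · obtain ⟨m, rfl⟩ : ∃ m, q = m + 12 := ⟨q - 12, by omega⟩
      rw [show m + 12 - 12 = m by omega]
      exact gap_k14 m (by omega) (by omega)
  · exact border_even_k14 q h

/-- **The borderline of `k = 15` for every `q ≥ 13`.** -/
theorem border_k15_all (q : ℕ) (hq : 13 ≤ q) : phiK (q + 15) q ≤ rhat q 15 (q - 13) := by
  rcases Nat.lt_or_ge q 160 with h | h
  · rcases Nat.lt_or_ge (2 * (q - 13)) (13 * 14 + 1) with hd | hd
    · exact phiK_le_rhat_bottom_regime 15 q (by norm_num) (by omega) (by omega)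
    · obtain ⟨m, rfl⟩ : ∃ m, q = m + 13 := ⟨q - 13, by omega⟩
      rw [show m + 13 - 13 = m by omega]
      exact gap_k15 m (by omega) (by omega)
  · exact border_k15 q h

/-- **The borderline of `k = 16` for every `q ≥ 14`.** -/
theorem border_k16_all (q : ℕ) (hq : 14 ≤ q) : phiK (q + 16) q ≤ rhat q 16 (q - 14) := by
  rcases Nat.lt_or_ge q 147 with h | h
  · rcases Nat.lt_or_ge (2 * (q - 14)) (14 * 15 + 1) with hd | hd
    · exact phiK_le_rhat_bottom_regime 16 q (by norm_num) (by omega) (by omega)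
    · obtain ⟨m, rfl⟩ : ∃ m, q = m + 14 := ⟨q - 14, by omega⟩
      rw [show m + 14 - 14 = m by omega]
      exact gap_k16 m (by omega) (by omega)
  · exact border_even_k16 q h

/-- **The borderline of `k = 17` for every `q ≥ 15`.** -/
theorem border_k17_all (q : ℕ) (hq : 15 ≤ q) : phiK (q + 17) q ≤ rhat q 17 (q - 15) := by
  rcases Nat.lt_or_ge q 167 with h | h
  · rcases Nat.lt_or_ge (2 * (q - 15)) (15 * 16 + 1) with hd | hd
    · exact phiK_le_rhat_bottom_regime 17 q (by norm_num) (by omega) (by omega)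
    · obtain ⟨m, rfl⟩ : ∃ m, q = m + 15 := ⟨q - 15, by omega⟩
      rw [show m + 15 - 15 = m by omega]
      exact gap_k17 m (by omega) (by omega)
  · exact border_k17 q h

/-- **The borderline of `k = 18` for every `q ≥ 16`.** -/
theorem border_k18_all (q : ℕ) (hq : 16 ≤ q) : phiK (q + 18) q ≤ rhat q 18 (q - 16) := by
  rcases Nat.lt_or_ge q 155 with h | h
  · rcases Nat.lt_or_ge (2 * (q - 16)) (16 * 17 + 1) with hd | hd
    · exact phiK_le_rhat_bottom_regime 18 q (by norm_num) (by omega) (by omega)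
    · obtain ⟨m, rfl⟩ : ∃ m, q = m + 16 := ⟨q - 16, by omega⟩
      rw [show m + 16 - 16 = m by omega]
      exact gap_k18 m (by omega) (by omega)
  · exact border_even_k18 q h

/-- **The borderline of `k = 19` for every `q ≥ 17`.** -/
theorem border_k19_all (q : ℕ) (hq : 17 ≤ q) : phiK (q + 19) q ≤ rhat q 19 (q - 17) := by
  rcases Nat.lt_or_ge q 176 with h | h
  · rcases Nat.lt_or_ge (2 * (q - 17)) (17 * 18 + 1) with hd | hd
    · exact phiK_le_rhat_bottom_regime 19 q (by norm_num) (by omega) (by omega)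
    · obtain ⟨m, rfl⟩ : ∃ m, q = m + 17 := ⟨q - 17, by omega⟩
      rw [show m + 17 - 17 = m by omega]
      exact gap_k19 m (by omega) (by omega)
  · exact border_k19 q h

/-- **THE CONJECTURE OF RECORD §28.7 — THE BORDERLINE SLICE `u = k − 2` IS PAID IN EVERY CELL**:
`Φ(q+k, q) ≤ R̂(q, k, q − (k−2))` for every `k ≥ 5` and every `q ≥ k − 2`. -/
theorem rhat_borderline_all (k q : ℕ) (hk : 5 ≤ k) (hq : k - 2 ≤ q) :
    phiK (q + k) q ≤ rhat q k (q - (k - 2)) := by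
  rcases Nat.lt_or_ge k 11 with h | h
  · exact rhat_borderline_of_le_ten k q hk (by omega) hq
  · rcases Nat.lt_or_ge k 20 with h' | h'
    · interval_cases k
      · exact border_k11_all q hq
      · exact border_k12_all q hq
      · exact border_k13_all q hq
      · exact border_k14_all q hq
      · exact border_k15_all q hq
      · exact border_k16_all q hq
      · exact border_k17_all q hq
      · exact border_k18_all q hq
      · exact border_k19_all q hq
    · rcases Nat.lt_or_ge (2 * q) (k * (k - 3)) with hq' | hq'
      · apply phiK_le_rhat_bottom_regime k q h hq
        -- 2(q − (k−2)) ≤ (k−2)(k−1) from 2q < k(k−3)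
        obtain ⟨K, rfl⟩ : ∃ K, k = K + 2 := ⟨k - 2, by omega⟩
        rw [show K + 2 - 2 = K by omega, show K + 2 - 1 = K + 1 by omega]
        rw [show K + 2 - 3 = K - 1 by omega] at hq'
        have hK : 1 ≤ K := by omega
        have e : (K + 2) * (K - 1) = K * (K + 1) - 2 := by
          obtain ⟨L, rfl⟩ : ∃ L, K = L + 1 := ⟨K - 1, by omega⟩
          rw [show L + 1 - 1 = L by omega]
          ring_nf
          omega
        rw [e] at hq'
        have : 2 * q < K * (K + 1) := by omega
        omega
      · exact phiK_le_rhat_border_twenty k q h' hq'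

/-- **THE MATROID LEVEL OF THE CONJECTURE OF RECORD**: at the tight layer `#E = (q+k) + q` of every finite matroid, every
member `Z` of the cell `(q+k, q)` with `#(flatPart M Z) = q − (k−2)` receives at least `Φ(q+k, q)` under Rule Q's equal split,
for every `k ≥ 5` and every `q ≥ k − 2`. -/
theorem ruleQRecv_ge_phiK_borderline_all {β : Type} (M : Matroid β) [M.Finite] {q k : ℕ} (hk : 5 ≤ k) (hq : k - 2 ≤ q)
    (hE : M.E.ncard = (q + k) + q) {Z : Set β} (hZ : Z ∈ cellMembers M (q + k) q)
    (hP : (flatPart M Z).ncard = q - (k - 2)) :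
    phiK (q + k) q ≤ ruleQRecv M (q + k) q Z :=
  ruleQRecv_ge_phiK_border_of_rhat M (rhat_borderline_all k q hk hq) hE hZ hP

end PercRepro
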